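import Summits.AtomisticToContinuum.FouriersLaw.Theorems.OddSectorIrreversibilityResponseDensitySmoothForecast
import Summits.AtomisticToContinuum.FouriersLaw.Theorems.OddSectorIrreversibilityResponseDensityGibbsTranspose
import Summits.AtomisticToContinuum.FouriersLaw.Theorems.OddSectorIrreversibilityResponseDensityConfining
import Literature.MathematicalPhysics.KineticTheory.LangevinChainDynkin
import Literature.MathematicalPhysics.KineticTheory.ConfinedBackward
import Mathlib.Analysis.Distribution.AEEqOfIntegralContDiff
import Mathlib.Analysis.Calculus.ParametricIntegral

/-!
# The pointwise backward equation `∂_s P_s F = L (P_s F)` for the pinned chain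

Helper file for item stmt-AtomisticToContinuum-9144 (`ResponseDensity`, route
`OddSectorIrreversibility`, sub-problem `FouriersLaw` of `AtomisticToContinuum`), third step towards
the detailed balance of the equilibrium kernels. For the pinned chain (`ω₂, γ, T_L > 0`,
`lam, β, T_R ≥ 0`, `N ≥ 1`) and `F ∈ C_c^∞`, the forecast `u(s, x) = P_s F(x)` is smooth in `x` for
`s > 0` (`…SmoothForecast.lean`) and:

* `pinnedChain_continuous_forecast_time` — `s ↦ P_{s⁺} g(x)` is continuous for bounded continuous `g`;
* `pinnedChain_hasDerivAt_forecast_dynkin` — `∂_s P_s F(x) = P_s(LF)(x)` (Dynkin, generator inside);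
* `pinnedChain_hasDerivAt_integral_mul_forecast` — the weak backward equation
  `d/ds ∫ ψ P_s F dx = ∫ (L̂ψ + 2γψ) P_s F dx` (`ψ ∈ C_c^∞`; the tree's `hasDerivAt_pairAct`);
* `pinnedChain_generator_forecast_eq` — **`L(P_s F) = P_s(LF)`** pointwise (`s > 0`): both are
  the density of `d/ds ∫ ψ P_s F dx` against every `ψ ∈ C_c^∞` (transpose identity
  `∫ (L̂ψ + 2γψ) u = ∫ ψ Lu` for smooth `u`), hence agree a.e., hence everywhere by continuity;
* `pinnedChain_hasDerivAt_forecast` — **`∂_s P_s F(x) = L(P_s F)(x)`**, `s > 0`.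

No definitions.
-/

noncomputable section

open MeasureTheory ProbabilityTheory Filter Topology Set Function Metric
open scoped NNReal ENNReal ContDiff

namespace Summit.AtomisticToContinuum.FouriersLaw.Theorems

open Literature.MathematicalPhysics.KineticTheory.HeatConduction
open Literature.Probability.Process Literature.MathematicalPhysics.KineticTheory OscillatorChain
open Literature.Analysis.Distribution

variable {N : ℕ}

section Backward

variable {ω₂ lam β γ : ℝ} (hω : 0 < ω₂) (hl : 0 ≤ lam) (hβ : 0 ≤ β) (hγ : 0 < γ) (hN : 0 < N)
  {T_L T_R : ℝ} (hL : 0 < T_L) (hR : 0 ≤ T_R)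
include hω hl hβ hγ

/-- For bounded continuous `g`, `s ↦ P_{s⁺} g(x)` is continuous (dominated convergence along the
continuous flow). -/
theorem pinnedChain_continuous_forecast_time (T_L T_R : ℝ) {g : PhaseSpace N → ℝ} (hg : Continuous g)
    {B : ℝ} (hB : ∀ y, ‖g y‖ ≤ B) (x : PhaseSpace N) :
    Continuous fun s : ℝ =>
      ∫ y, g y ∂((pinnedChain ω₂ lam β γ).transitionKernel N T_L T_R s.toNNReal x) := by
  have hrep : (fun s : ℝ => ∫ y, g y ∂((pinnedChain ω₂ lam β γ).transitionKernel N T_L T_R s.toNNReal x)) =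
      fun s => ∫ w, g ((pinnedChain ω₂ lam β γ).solMap N T_L T_R (s.toNNReal : ℝ) x (pairPath w))
        ∂wienerPair := by
    funext s
    exact pinnedChain_integral_transitionKernel hω hl hβ hγ.le N T_L T_R _ x hg.aestronglyMeasurable
  rw [hrep]
  have hflow_cont : ∀ w, Continuous fun s : ℝ =>
      (pinnedChain ω₂ lam β γ).solMap N T_L T_R (s.toNNReal : ℝ) x (pairPath w) :=
    fun w => (pinnedChain_continuous_solMap hω hl hβ hγ.le N T_L T_R x (pairPath w)).comp
      (continuous_subtype_val.comp continuous_real_toNNReal)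
  have hflow_meas : ∀ s : ℝ, Measurable fun w =>
      (pinnedChain ω₂ lam β γ).solMap N T_L T_R (s.toNNReal : ℝ) x (pairPath w) :=
    fun s => pinnedChain_measurable_solMap_pairPath_right hω hl hβ hγ.le N T_L T_R _ x
  exact continuous_of_dominated (fun s => (hg.measurable.comp (hflow_meas s)).aestronglyMeasurable)
    (fun s => Eventually.of_forall fun w => hB _) (integrable_const B)
    (Eventually.of_forall fun w => hg.comp (hflow_cont w))

include hN hL hR

/-- **Dynkin, differentiated**: for `F ∈ C_c^∞` and `s > 0`, `∂_s P_s F(x) = P_s(LF)(x)`. -/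
theorem pinnedChain_hasDerivAt_forecast_dynkin {F : PhaseSpace N → ℝ} (hF : ContDiff ℝ ∞ F)
    (hFc : HasCompactSupport F) {s : ℝ} (hs : 0 < s) (x : PhaseSpace N) :
    HasDerivAt (fun r : ℝ => ∫ y, F y ∂((pinnedChain ω₂ lam β γ).transitionKernel N T_L T_R r.toNNReal x))
      (∫ y, (pinnedChain ω₂ lam β γ).generator N T_L T_R F y
        ∂((pinnedChain ω₂ lam β γ).transitionKernel N T_L T_R s.toNNReal x)) s := by
  have hF2 : ContDiff ℝ 2 F := hF.of_le (by norm_cast)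
  set g : ℝ → ℝ := fun r => ∫ y, (pinnedChain ω₂ lam β γ).generator N T_L T_R F y
    ∂((pinnedChain ω₂ lam β γ).transitionKernel N T_L T_R r.toNNReal x) with hg
  have hLc : Continuous ((pinnedChain ω₂ lam β γ).generator N T_L T_R F) :=
    (pinnedChain ω₂ lam β γ).continuous_generator (pinnedChain_contDiff_U ω₂ lam β γ)
      (pinnedChain_contDiff_V ω₂ lam β γ) N T_L T_R hF2
  obtain ⟨CL, hCL⟩ := (pinnedChain ω₂ lam β γ).exists_bound_generator (pinnedChain_contDiff_U ω₂ lam β γ)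
    (pinnedChain_contDiff_V ω₂ lam β γ) N T_L T_R hF2 hFc
  have hgc : Continuous g := pinnedChain_continuous_forecast_time hω hl hβ hγ T_L T_R hLc hCL x
  -- Dynkin: `P_r F(x) = F(x) + ∫₀ʳ g` for `r ≥ 0`
  have hdyn : ∀ r : ℝ, 0 ≤ r →
      ∫ y, F y ∂((pinnedChain ω₂ lam β γ).transitionKernel N T_L T_R r.toNNReal x) =
        F x + ∫ τ in (0 : ℝ)..r, g τ := by
    intro r hr
    have h := pinnedChain_dynkin hω hl hβ hγ.le hN hL.le hR F hF hFc r.toNNReal x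
    rw [Real.coe_toNNReal _ hr] at h
    linarith
  have hprim : HasDerivAt (fun r : ℝ => F x + ∫ τ in (0 : ℝ)..r, g τ) (g s) s :=
    (intervalIntegral.integral_hasDerivAt_right (hgc.intervalIntegrable _ _)
      (hgc.stronglyMeasurableAtFilter _ _) hgc.continuousAt).const_add _
  refine hprim.congr_of_eventuallyEq ?_
  filter_upwards [Ioi_mem_nhds hs] with r hr
  exact hdyn r (le_of_lt hr)

omit hL hR in
/-- **The weak backward equation**: for `ψ, F ∈ C_c^∞` and `s > 0`,
`d/ds ∫ ψ(x) P_s F(x) dx = ∫ (L̂ψ + 2γψ)(x) P_s F(x) dx` (`L̂ = sdeGenerator (-Y) v_L v_R`). -/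
theorem pinnedChain_hasDerivAt_integral_mul_forecast {ψ F : PhaseSpace N → ℝ} (hψ : ContDiff ℝ ∞ ψ)
    (hψc : HasCompactSupport ψ) (hF : ContDiff ℝ ∞ F) (hFc : HasCompactSupport F) {s : ℝ} (hs : 0 < s) :
    HasDerivAt (fun r : ℝ => ∫ x, ψ x *
        ∫ y, F y ∂((pinnedChain ω₂ lam β γ).transitionKernel N T_L T_R r.toNNReal x))
      (∫ x, (sdeGenerator (fun y => -(pinnedChain ω₂ lam β γ).drift N y)
          ((pinnedChain ω₂ lam β γ).bathVecL N T_L) ((pinnedChain ω₂ lam β γ).bathVecR N T_R) ψ x +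
            2 * γ * ψ x) *
        ∫ y, F y ∂((pinnedChain ω₂ lam β γ).transitionKernel N T_L T_R s.toNNReal x)) s := by
  haveI := isAddHaarMeasure_volume_phaseSpace N
  have hPc : (pinnedChain ω₂ lam β γ).IsConfining := SubdiffusiveBondHeat.pinnedChain_isConfining hω hl hβ hγ.le
  have hU : ContDiff ℝ ∞ (pinnedChain ω₂ lam β γ).U := pinnedChain_contDiff_U ω₂ lam β γ
  have hV : ContDiff ℝ ∞ (pinnedChain ω₂ lam β γ).V := pinnedChain_contDiff_V ω₂ lam β γ
  have hψ2 : ContDiff ℝ 2 ψ := hψ.of_le (by norm_cast)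
  -- the pair observable `H(x, y) = F(y) ψ(x)`
  set H : PhaseSpace N × PhaseSpace N → ℝ := fun p => F p.2 * ψ p.1 with hH_def
  have hH : ContDiff ℝ 2 H := (hF.comp contDiff_snd).mul (hψ.comp contDiff_fst) |>.of_le (by norm_cast)
  have hHc : HasCompactSupport H := by
    refine HasCompactSupport.intro' (hψc.prod hFc) (hψc.isCompact.prod hFc.isCompact |>.isClosed) ?_
    intro p hp
    simp only [Set.mem_prod, not_and_or] at hp
    rcases hp with h1 | h2
    · simp [hH_def, image_eq_zero_of_notMem_tsupport h1]
    · simp [hH_def, image_eq_zero_of_notMem_tsupport h2]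
  have hid := (hPc.confinedDrift N).toConfinedDrift.hasDerivAt_pairAct
    (hPc.bathVecL_mem_noise N T_L) (hPc.bathVecR_mem_noise N T_R) volume (hPc.reversedDrift N)
    (hPc.bathVecL_mem_reversedDrift_noise N T_L) (hPc.bathVecR_mem_reversedDrift_noise N T_R)
    (fun _ => rfl) ((pinnedChain ω₂ lam β γ).trace_fderiv_drift hU hV hN) hH hHc hs
  -- identify the pair actions
  have hgen : ∀ p : PhaseSpace N × PhaseSpace N,
      sdeGeneratorFst (fun y => -(pinnedChain ω₂ lam β γ).drift N y)
        ((pinnedChain ω₂ lam β γ).bathVecL N T_L) ((pinnedChain ω₂ lam β γ).bathVecR N T_R) H p =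
      F p.2 * sdeGenerator (fun y => -(pinnedChain ω₂ lam β γ).drift N y)
        ((pinnedChain ω₂ lam β γ).bathVecL N T_L) ((pinnedChain ω₂ lam β γ).bathVecR N T_R) ψ p.1 := by
    rintro ⟨x', y'⟩
    rw [sdeGeneratorFst_apply]
    exact sdeGenerator_const_mul _ _ _ hψ2 (F y') x'
  have hpa : ∀ (r : ℝ≥0), pairAct ((pinnedChain ω₂ lam β γ).drift N) ((pinnedChain ω₂ lam β γ).bathVecL N T_L)
      ((pinnedChain ω₂ lam β γ).bathVecR N T_R) volume H r =
      ∫ x, ψ x * ∫ y, F y ∂((pinnedChain ω₂ lam β γ).transitionKernel N T_L T_R r x) := by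
    intro r
    rw [pairAct_def, pinnedChain_sdeKernel_eq_transitionKernel N T_L T_R hω hl hβ hγ.le]
    refine integral_congr_ae (Eventually.of_forall fun x => ?_)
    simp only [hH_def]
    rw [integral_mul_const, mul_comm]
  have hpa' : ∀ (r : ℝ≥0), pairAct ((pinnedChain ω₂ lam β γ).drift N) ((pinnedChain ω₂ lam β γ).bathVecL N T_L)
      ((pinnedChain ω₂ lam β γ).bathVecR N T_R) volume
      (sdeGeneratorFst (fun y => -(pinnedChain ω₂ lam β γ).drift N y)
        ((pinnedChain ω₂ lam β γ).bathVecL N T_L) ((pinnedChain ω₂ lam β γ).bathVecR N T_R) H) r =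
      ∫ x, sdeGenerator (fun y => -(pinnedChain ω₂ lam β γ).drift N y)
        ((pinnedChain ω₂ lam β γ).bathVecL N T_L) ((pinnedChain ω₂ lam β γ).bathVecR N T_R) ψ x *
        ∫ y, F y ∂((pinnedChain ω₂ lam β γ).transitionKernel N T_L T_R r x) := by
    intro r
    rw [pairAct_def, pinnedChain_sdeKernel_eq_transitionKernel N T_L T_R hω hl hβ hγ.le]
    refine integral_congr_ae (Eventually.of_forall fun x => ?_)
    simp only [hgen]
    rw [integral_mul_const, mul_comm]
  simp only [hpa, hpa'] at hid
  refine hid.congr_deriv ?_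
  have hI1 : Integrable (fun x => ψ x *
      ∫ y, F y ∂((pinnedChain ω₂ lam β γ).transitionKernel N T_L T_R s.toNNReal x)) := by
    obtain ⟨CF, hCF⟩ : ∃ C, ∀ y, ‖F y‖ ≤ C := hF.continuous.bounded_above_of_compact_support hFc
    exact (hψ.continuous.mul (pinnedChain_continuous_integral_transitionKernel hω hl hβ hγ.le N T_L T_R _
      hF.continuous hCF)).integrable_of_hasCompactSupport hψc.mul_right
  have hI2 : Integrable (fun x => sdeGenerator (fun y => -(pinnedChain ω₂ lam β γ).drift N y)
      ((pinnedChain ω₂ lam β γ).bathVecL N T_L) ((pinnedChain ω₂ lam β γ).bathVecR N T_R) ψ x *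
      ∫ y, F y ∂((pinnedChain ω₂ lam β γ).transitionKernel N T_L T_R s.toNNReal x)) := by
    obtain ⟨CF, hCF⟩ : ∃ C, ∀ y, ‖F y‖ ≤ C := hF.continuous.bounded_above_of_compact_support hFc
    have hY'c : Continuous fun y => -(pinnedChain ω₂ lam β γ).drift N y :=
      ((pinnedChain ω₂ lam β γ).contDiff_drift hU hV N).continuous.neg
    refine ((continuous_sdeGenerator _ _ hY'c hψ2).mul (pinnedChain_continuous_integral_transitionKernel hω hl hβ
      hγ.le N T_L T_R _ hF.continuous hCF)).integrable_of_hasCompactSupport ?_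
    exact (hasCompactSupport_sdeGenerator _ _ hψc).mul_right
  rw [show (pinnedChain ω₂ lam β γ).γ = γ from rfl, ← integral_const_mul, ← integral_add (hI1.const_mul _) hI2]
  refine integral_congr_ae (Eventually.of_forall fun x => ?_)
  ring

/-- **`L(P_s F) = P_s(LF)` pointwise** for `F ∈ C_c^∞` and `s > 0`: the generator commutes with the
transition kernels on `C_c^∞`. -/
theorem pinnedChain_generator_forecast_eq {F : PhaseSpace N → ℝ} (hF : ContDiff ℝ ∞ F)
    (hFc : HasCompactSupport F) {s : ℝ} (hs : 0 < s) (x : PhaseSpace N) :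
    (pinnedChain ω₂ lam β γ).generator N T_L T_R
        (fun z => ∫ y, F y ∂((pinnedChain ω₂ lam β γ).transitionKernel N T_L T_R s.toNNReal z)) x =
      ∫ y, (pinnedChain ω₂ lam β γ).generator N T_L T_R F y
        ∂((pinnedChain ω₂ lam β γ).transitionKernel N T_L T_R s.toNNReal x) := by
  haveI := isAddHaarMeasure_volume_phaseSpace N
  have hU : ContDiff ℝ ∞ (pinnedChain ω₂ lam β γ).U := pinnedChain_contDiff_U ω₂ lam β γ
  have hV : ContDiff ℝ ∞ (pinnedChain ω₂ lam β γ).V := pinnedChain_contDiff_V ω₂ lam β γ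
  have hF2 : ContDiff ℝ 2 F := hF.of_le (by norm_cast)
  have hγL : 0 ≤ (pinnedChain ω₂ lam β γ).γ * T_L := mul_nonneg hγ.le hL.le
  have hγR : 0 ≤ (pinnedChain ω₂ lam β γ).γ * T_R := mul_nonneg hγ.le hR
  obtain ⟨CF, hCF⟩ : ∃ C, ∀ y, ‖F y‖ ≤ C := hF.continuous.bounded_above_of_compact_support hFc
  have hLc : Continuous ((pinnedChain ω₂ lam β γ).generator N T_L T_R F) :=
    (pinnedChain ω₂ lam β γ).continuous_generator (pinnedChain_contDiff_U ω₂ lam β γ)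
      (pinnedChain_contDiff_V ω₂ lam β γ) N T_L T_R hF2
  obtain ⟨CL, hCL⟩ := (pinnedChain ω₂ lam β γ).exists_bound_generator (pinnedChain_contDiff_U ω₂ lam β γ)
    (pinnedChain_contDiff_V ω₂ lam β γ) N T_L T_R hF2 hFc
  -- name the two sides as functions
  obtain ⟨u, hu⟩ : ∃ u : ℝ → PhaseSpace N → ℝ, u = fun r z =>
      ∫ y, F y ∂((pinnedChain ω₂ lam β γ).transitionKernel N T_L T_R r.toNNReal z) := ⟨_, rfl⟩
  obtain ⟨g, hg⟩ : ∃ g : ℝ → PhaseSpace N → ℝ, g = fun r z =>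
      ∫ y, (pinnedChain ω₂ lam β γ).generator N T_L T_R F y
        ∂((pinnedChain ω₂ lam β γ).transitionKernel N T_L T_R r.toNNReal z) := ⟨_, rfl⟩
  have hux : ∀ r z, u r z = ∫ y, F y ∂((pinnedChain ω₂ lam β γ).transitionKernel N T_L T_R r.toNNReal z) :=
    fun r z => by rw [hu]
  have hgx : ∀ r z, g r z = ∫ y, (pinnedChain ω₂ lam β γ).generator N T_L T_R F y
      ∂((pinnedChain ω₂ lam β γ).transitionKernel N T_L T_R r.toNNReal z) := fun r z => by rw [hg]
  rw [show (fun z => ∫ y, F y ∂((pinnedChain ω₂ lam β γ).transitionKernel N T_L T_R s.toNNReal z)) = u s by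
    rw [hu], ← hgx s x]
  -- regularity of both sides
  have hucont : ∀ r, Continuous (u r) := fun r => by
    rw [hu]
    exact pinnedChain_continuous_integral_transitionKernel hω hl hβ hγ.le N T_L T_R _ hF.continuous hCF
  have hsm : ContDiff ℝ ∞ (u s) := by
    have h := pinnedChain_contDiffOn_forecast hω hl hβ hγ hN hL hR hF.continuous hFc
    have h2 := h.comp_contDiff (contDiff_const.prodMk contDiff_id) fun z => ⟨hs, Set.mem_univ _⟩
    rw [hu]
    exact h2
  have hLu : Continuous ((pinnedChain ω₂ lam β γ).generator N T_L T_R (u s)) :=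
    (pinnedChain ω₂ lam β γ).continuous_generator (pinnedChain_contDiff_U ω₂ lam β γ)
      (pinnedChain_contDiff_V ω₂ lam β γ) N T_L T_R (hsm.of_le (by norm_cast))
  have hgc : Continuous (g s) := by
    rw [hg]
    exact pinnedChain_continuous_integral_transitionKernel hω hl hβ hγ.le N T_L T_R _ hLc hCL
  have hgb : ∀ r z, ‖g r z‖ ≤ CL := by
    intro r z
    haveI := pinnedChain_isMarkovKernel_transitionKernel hω hl hβ hγ.le N T_L T_R r.toNNReal
    rw [hgx]
    calc _ ≤ ∫ y, ‖(pinnedChain ω₂ lam β γ).generator N T_L T_R F y‖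
          ∂((pinnedChain ω₂ lam β γ).transitionKernel N T_L T_R r.toNNReal z) := norm_integral_le_integral_norm _
      _ ≤ ∫ y, CL ∂((pinnedChain ω₂ lam β γ).transitionKernel N T_L T_R r.toNNReal z) :=
          integral_mono_of_nonneg (Eventually.of_forall fun _ => norm_nonneg _) (integrable_const _)
            (Eventually.of_forall fun y => hCL y)
      _ = CL := by simp
  -- the two derivatives of `r ↦ ∫ ψ u_r`
  have hderu : ∀ z, ∀ r : ℝ, 0 < r → HasDerivAt (fun r => u r z) (g r z) r := by
    intro z r hr
    have h := pinnedChain_hasDerivAt_forecast_dynkin hω hl hβ hγ hN hL hR hF hFc hr z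
    rw [← hgx] at h
    refine h.congr_of_eventuallyEq (Eventually.of_forall fun r' => hux r' z)
  have htest : ∀ ψ : PhaseSpace N → ℝ, ContDiff ℝ ∞ ψ → HasCompactSupport ψ →
      ∫ z, ψ z * (pinnedChain ω₂ lam β γ).generator N T_L T_R (u s) z = ∫ z, ψ z * g s z := by
    intro ψ hψ hψc
    have h1 := pinnedChain_hasDerivAt_integral_mul_forecast hω hl hβ hγ hN (T_L := T_L) (T_R := T_R) hψ hψc hF hFc hs
    have h0 := langevin_integral_revGenerator_mul (pinnedChain ω₂ lam β γ) hU hV hN hγL hγR hψ hψc hsm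
    simp only [show (pinnedChain ω₂ lam β γ).γ = γ from rfl] at h0
    have h1u : HasDerivAt (fun r : ℝ => ∫ z, ψ z * u r z)
        (∫ z, (sdeGenerator (fun y => -(pinnedChain ω₂ lam β γ).drift N y)
          ((pinnedChain ω₂ lam β γ).bathVecL N T_L) ((pinnedChain ω₂ lam β γ).bathVecR N T_R) ψ z +
            2 * γ * ψ z) * u s z) s := by
      rw [hu]; exact h1
    have h1' : HasDerivAt (fun r : ℝ => ∫ z, ψ z * u r z)
        (∫ z, ψ z * (pinnedChain ω₂ lam β γ).generator N T_L T_R (u s) z) s := by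
      rw [← h0]; exact h1u
    have h2 : HasDerivAt (fun r : ℝ => ∫ z, ψ z * u r z) (∫ z, ψ z * g s z) s := by
      have hmeas : ∀ r : ℝ, AEStronglyMeasurable (fun z => ψ z * u r z) volume := fun r =>
        (hψ.continuous.mul (hucont r)).aestronglyMeasurable
      have hmeas' : AEStronglyMeasurable (fun z => ψ z * g s z) volume :=
        (hψ.continuous.mul hgc).aestronglyMeasurable
      have hint : Integrable (fun z => ψ z * u s z) :=
        (hψ.continuous.mul (hucont s)).integrable_of_hasCompactSupport hψc.mul_right
      have hbound : ∀ᵐ z ∂(volume : Measure (PhaseSpace N)), ∀ r ∈ ball s (s / 2),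
          ‖ψ z * g r z‖ ≤ |ψ z| * CL := by
        refine Eventually.of_forall fun z r _ => ?_
        rw [norm_mul, Real.norm_eq_abs]
        exact mul_le_mul_of_nonneg_left (hgb r z) (abs_nonneg _)
      have hbint : Integrable (fun z => |ψ z| * CL) :=
        (hψ.continuous.abs.mul continuous_const).integrable_of_hasCompactSupport (hψc.norm.mul_right)
      have hdiff : ∀ᵐ z ∂(volume : Measure (PhaseSpace N)), ∀ r ∈ ball s (s / 2),
          HasDerivAt (fun r => ψ z * u r z) (ψ z * g r z) r := by
        refine Eventually.of_forall fun z r hr => ?_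
        have hr0 : 0 < r := by
          rw [mem_ball, Real.dist_eq] at hr
          have := abs_lt.1 hr
          linarith
        exact (hderu z r hr0).const_mul _
      exact (hasDerivAt_integral_of_dominated_loc_of_deriv_le (ball_mem_nhds s (by positivity))
        (Eventually.of_forall hmeas) hint hmeas' hbound hbint hdiff).2
    exact h1'.unique h2
  -- hence a.e. equality, then everywhere by continuity
  have hae : ∀ᵐ z ∂(volume : Measure (PhaseSpace N)),
      (pinnedChain ω₂ lam β γ).generator N T_L T_R (u s) z - g s z = 0 := by
    refine ae_eq_zero_of_integral_contDiff_smul_eq_zero ((hLu.sub hgc).locallyIntegrable) fun ψ hψ hψc => ?_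
    have hi1 : Integrable (fun z => ψ z * (pinnedChain ω₂ lam β γ).generator N T_L T_R (u s) z) :=
      (hψ.continuous.mul hLu).integrable_of_hasCompactSupport hψc.mul_right
    have hi2 : Integrable (fun z => ψ z * g s z) :=
      (hψ.continuous.mul hgc).integrable_of_hasCompactSupport hψc.mul_right
    simp only [smul_eq_mul, mul_sub]
    rw [integral_sub hi1 hi2, htest ψ hψ hψc, sub_self]
  have heq : (pinnedChain ω₂ lam β γ).generator N T_L T_R (u s) = g s := by
    have h : ((pinnedChain ω₂ lam β γ).generator N T_L T_R (u s)) =ᵐ[volume] g s := by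
      filter_upwards [hae] with z hz
      linarith
    exact Measure.eq_of_ae_eq h hLu hgc
  exact congrFun heq x

/-- **The pointwise backward equation**: for `F ∈ C_c^∞`, `s > 0` and every `x`,
`∂_s P_s F(x) = L(P_s F)(x)`. -/
theorem pinnedChain_hasDerivAt_forecast {F : PhaseSpace N → ℝ} (hF : ContDiff ℝ ∞ F)
    (hFc : HasCompactSupport F) {s : ℝ} (hs : 0 < s) (x : PhaseSpace N) :
    HasDerivAt (fun r : ℝ => ∫ y, F y ∂((pinnedChain ω₂ lam β γ).transitionKernel N T_L T_R r.toNNReal x))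
      ((pinnedChain ω₂ lam β γ).generator N T_L T_R
        (fun z => ∫ y, F y ∂((pinnedChain ω₂ lam β γ).transitionKernel N T_L T_R s.toNNReal z)) x) s := by
  rw [pinnedChain_generator_forecast_eq hω hl hβ hγ hN hL hR hF hFc hs x]
  exact pinnedChain_hasDerivAt_forecast_dynkin hω hl hβ hγ hN hL hR hF hFc hs x

end Backward

end Summit.AtomisticToContinuum.FouriersLaw.Theorems

end
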